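import Literature.NumberTheory.EllipticCurves.UnramifiedCoboundaryInputs
import Literature.NumberTheory.EllipticCurves.PeriodIndexSupport
import Literature.NumberTheory.Automorphic.AdicCompletionResidueCard
import HarnessLib

/-!
# Unramified classes of `H¹(K_v, E)` vanish at good reduction (Milne, ADT I.3.8), and the
# finiteness of the support of a class of `H¹(K, E)` (Clark–Sharif 2010, §1.1)

`Proofs` file (theorems only, no definitions, no named facts) in topic
`NumberTheory/EllipticCurves`: the discharges

* `Literature.NumberTheory.EllipticCurves.Milne2006_unramifiedClass_eq_zero_holds` of the named
  fact `Milne2006_unramifiedClass_eq_zero` (`PeriodIndexSupport`; Milne, *Arithmetic Duality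
  Theorems*, Prop. I.3.8, good reduction: a continuous crossed homomorphism
  `Γ_{K_v} → E(K̄_v)` vanishing on the inertia group has trivial class), and
* `Literature.NumberTheory.EllipticCurves.finite_support_holds` of the named fact `finite_support`
  (`PeriodIndex`; Clark–Sharif, *Period, index and potential Ш*, ANT 4 (2010), §1.1: a class
  `η ∈ H¹(K, E)` is locally trivial at all but finitely many places), by the tree's reduction
  `finite_support_of_unramifiedClass_eq_zero` (`PeriodIndexSupport`).

## The proof of I.3.8 (`WeierstrassCurve.exists_eq_map_sub_of_cocycle`)

For the good model `V = M ⊗ K̄_v` (`M = W.localMinimalIntegralModel v`) and a crossed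
homomorphism `g : Γ_{K_v} → V(K̄_v)` with open zero set vanishing on `I = I_𝔐`:
1. (`GoodReductionLangLift`) with a local arithmetic Frobenius `F`
   (`exists_isArithFrobAt_localAbsIntegers`), Lang's theorem on `Ṽ(k̄_v)` and Hensel give an
   `I`-invariant `b` with `m₁ = g F - (F b - b)` in the kernel of reduction `V₁`;
   `g₁ = g - ∂b` vanishes on `I`, so `m₁` is `I`-invariant, with coordinates in `K_v^nr`
   (`mem_maxUnramified_iff_forall_inertia`), indeed in `K_v(T)` for finitely many roots of unity
   `T` of orders prime to `p` (`IntermediateField.exists_finset_of_mem_adjoin`);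
2. the level: `n = m₀ φ(N₀)` where `F^{m₀}` lies in an open normal subgroup of finite index inside
   `{g₁ = 0}` (`krullTopology_mem_nhds_one_iff_of_normal`, `restrictNormalHom`) and `N₀` is
   the product of the orders of `T`, prime to `q` (`Nat.ModEq.pow_totient`); then
   `g₁(Fⁿ) = 0` and `T ⊆ μ_{qⁿ-1} ⊆ K_n = K_v(ζ)`, `ζ` a primitive `(qⁿ-1)`-th root
   (`UnramifiedLayerRootsProofs`);
3. (`UnramifiedFormalGroupH1Proofs`, `UnramifiedCoboundaryInputs`, `UnramifiedLayerRootsProofs`)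
   `Σ_{j<n} Fʲ m₁ = g₁(Fⁿ) = O`, so successive approximation in the complete layer `K_n` gives
   `Q ∈ V₁(K_n)` with `F Q - Q = m₁`;
4. `g₂ = g₁ - ∂Q` vanishes on `I` and at `F` and has open zero set, a subgroup; by the density of
   `⟨F, I⟩` (`eq_top_of_isOpen_of_frobenius_mem_of_inertia_le`, `LocalFrobeniusGenerationProofs`)
   `g₂ = 0`, i.e. `g = ∂(b + Q)`.
The transport `E(K̄_v) = localPoints W K_v ≃ V(K̄_v)` is that of `SelmerFiniteProofs`
(`congrEquiv_smul`, `pointEquivBaseChange_map_algEquiv`, `congrEquiv_baseChange_map`).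

## References

* [MilneADT2006] J. S. Milne, *Arithmetic Duality Theorems*, 2nd ed. (2006), Ch. I Prop. 3.8
  and its proof (Lang's theorem, Hensel's lemma), Notes to §I.3 (Tate 1962).
* [ClarkSharif2010] P. L. Clark, S. Sharif, *Period, index and potential Ш*, Algebra & Number
  Theory 4 (2010), §1.1 — doi:10.2140/ant.2010.4.151, arXiv:0811.3019.
* [LangTate1958] S. Lang, J. Tate, *Principal homogeneous spaces over abelian varieties*,
  Amer. J. Math. 80 (1958).
* [SerreLocalFields1979] J.-P. Serre, *Local Fields*, V §2, X §1, XIII §1.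

## Design

`noncomputable section`; no definitions, no local notation (the Galois action on points of
`X ⊗ K̄_v` is written `WeierstrassCurve.Affine.Point.map (W' := X) (toAlgEquiv σ : K̄_v →ₐ[K_v] K̄_v)`
throughout, hence the long lines). Heartbeats raised for the core theorem only. Axioms:
`propext`, `Classical.choice`, `Quot.sound`.
-/

noncomputable section

open scoped Classical NNReal Topology
open NumberField IsDedekindDomain Field Polynomial ValuativeRel

universe u

namespace WeierstrassCurve

open Literature.NumberTheory.EllipticCurves Literature.NumberTheory.EllipticCurves.FormalGroupChart
  Literature.NumberTheory.GaloisRepresentations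
  Literature.NumberTheory.GaloisRepresentations.IsNonarchimedeanLocalField IsDedekindDomain.HeightOneSpectrum

variable {K : Type u} [Field K] [NumberField K] {v : HeightOneSpectrum (𝓞 K)}
  {w : Valuation (AlgebraicClosure (v.adicCompletion K)) ℝ≥0}

/-! ## Crossed homomorphisms `Γ_{K_v} → E(K̄_v)`: algebra and topology -/

section Cocycle

variable {X : WeierstrassCurve (adicCompletion K v)}


/-- `WeierstrassCurve.Affine.Point.map (W' := X) ((absoluteGaloisGroup.toAlgEquiv (v.adicCompletion K) (1) : AlgebraicClosure (v.adicCompletion K) ≃ₐ[v.adicCompletion K] AlgebraicClosure (v.adicCompletion K)) : AlgebraicClosure (v.adicCompletion K) →ₐ[v.adicCompletion K] AlgebraicClosure (v.adicCompletion K)) = id` on points. [folklore] -/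
theorem map_gal_one (P : (X.baseChange (AlgebraicClosure (v.adicCompletion K))).toAffine.Point) : WeierstrassCurve.Affine.Point.map (W' := X) ((absoluteGaloisGroup.toAlgEquiv (v.adicCompletion K) ((1 : absoluteGaloisGroup (v.adicCompletion K))) : AlgebraicClosure (v.adicCompletion K) ≃ₐ[v.adicCompletion K] AlgebraicClosure (v.adicCompletion K)) : AlgebraicClosure (v.adicCompletion K) →ₐ[v.adicCompletion K] AlgebraicClosure (v.adicCompletion K)) P = P := by
  rcases P with _ | ⟨x, y, h⟩ <;> rfl

/-- `WeierstrassCurve.Affine.Point.map (W' := X) ((absoluteGaloisGroup.toAlgEquiv (v.adicCompletion K) (στ) : AlgebraicClosure (v.adicCompletion K) ≃ₐ[v.adicCompletion K] AlgebraicClosure (v.adicCompletion K)) : AlgebraicClosure (v.adicCompletion K) →ₐ[v.adicCompletion K] AlgebraicClosure (v.adicCompletion K)) = WeierstrassCurve.Affine.Point.map (W' := X) ((absoluteGaloisGroup.toAlgEquiv (v.adicCompletion K) (σ) : AlgebraicClosure (v.adicCompletion K) ≃ₐ[v.adicCompletion K] AlgebraicClosure (v.adicCompletion K)) : AlgebraicClosure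 (v.adicCompletion K) →ₐ[v.adicCompletion K] AlgebraicClosure (v.adicCompletion K)) ∘ WeierstrassCurve.Affine.Point.map (W' := X) ((absoluteGaloisGroup.toAlgEquiv (v.adicCompletion K) (τ) : AlgebraicClosure (v.adicCompletion K) ≃ₐ[v.adicCompletion K] AlgebraicClosure (v.adicCompletion K)) : AlgebraicClosure (v.adicCompletion K) →ₐ[v.adicCompletion K] AlgebraicClosure (v.adicCompletion K))` on points. [folklore] -/
theorem map_gal_mul (σ τ : absoluteGaloisGroup (v.adicCompletion K)) (P : (X.baseChange (AlgebraicClosure (v.adicCompletion K))).toAffine.Point) :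
    WeierstrassCurve.Affine.Point.map (W' := X) ((absoluteGaloisGroup.toAlgEquiv (v.adicCompletion K) (σ * τ) : AlgebraicClosure (v.adicCompletion K) ≃ₐ[v.adicCompletion K] AlgebraicClosure (v.adicCompletion K)) : AlgebraicClosure (v.adicCompletion K) →ₐ[v.adicCompletion K] AlgebraicClosure (v.adicCompletion K)) P = WeierstrassCurve.Affine.Point.map (W' := X) ((absoluteGaloisGroup.toAlgEquiv (v.adicCompletion K) (σ) : AlgebraicClosure (v.adicCompletion K) ≃ₐ[v.adicCompletion K] AlgebraicClosure (v.adicCompletion K)) : AlgebraicClosure (v.adicCompletion K) →ₐ[v.adicCompletion K] AlgebraicClosure (v.adicCompletion K)) (WeierstrassCurve.Affine.Point.map (W' := X) ((absoluteGaloisGroup.toAlgEquiv (v.adicCompletion K) (τ) : AlgebraicClosure (v.adicCompletion K) ≃ₐ[v.adicCompletion K] AlgebraicClosure (v.adicCompletion K)) : AlgebraicClosure (v.adicCompletion K) →ₐ[v.adicCompletion K] AlgebraicClosure (v.adicCompletion K)) P) := by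
  rw [map_mul, Affine.Point.map_map]
  rfl

/-- `WeierstrassCurve.Affine.Point.map (W' := X) ((absoluteGaloisGroup.toAlgEquiv (v.adicCompletion K) (σ ^ j) : AlgebraicClosure (v.adicCompletion K) ≃ₐ[v.adicCompletion K] AlgebraicClosure (v.adicCompletion K)) : AlgebraicClosure (v.adicCompletion K) →ₐ[v.adicCompletion K] AlgebraicClosure (v.adicCompletion K)) = WeierstrassCurve.Affine.Point.map (W' := X) ((absoluteGaloisGroup.toAlgEquiv (v.adicCompletion K) (σ) : AlgebraicClosure (v.adicCompletion K) ≃ₐ[v.adicCompletion K] AlgebraicClosure (v.adicCompletion K)) : AlgebraicClosure (v.adicCompletion K) →ₐ[v.adicCompletion K] AlgebraicClosure (v.adicCompletion K))ʲ`: powers of the coerced algebra homomorphism. [folklore] -/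
theorem map_gal_pow (σ : absoluteGaloisGroup (v.adicCompletion K)) (j : ℕ) (P : (X.baseChange (AlgebraicClosure (v.adicCompletion K))).toAffine.Point) :
    Affine.Point.map (W' := X) ((((absoluteGaloisGroup.toAlgEquiv (v.adicCompletion K)) σ : (AlgebraicClosure (v.adicCompletion K)) ≃ₐ[(v.adicCompletion K)] (AlgebraicClosure (v.adicCompletion K))) : (AlgebraicClosure (v.adicCompletion K)) →ₐ[(v.adicCompletion K)] (AlgebraicClosure (v.adicCompletion K))) ^ j) P = WeierstrassCurve.Affine.Point.map (W' := X) ((absoluteGaloisGroup.toAlgEquiv (v.adicCompletion K) (σ ^ j) : AlgebraicClosure (v.adicCompletion K) ≃ₐ[v.adicCompletion K] AlgebraicClosure (v.adicCompletion K)) : AlgebraicClosure (v.adicCompletion K) →ₐ[v.adicCompletion K] AlgebraicClosure (v.adicCompletion K)) P := by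
  rw [coe_gal_pow]

/-- A crossed homomorphism vanishes at `1`. [folklore] -/
theorem cocycle_apply_one {g : absoluteGaloisGroup (v.adicCompletion K) → (X.baseChange (AlgebraicClosure (v.adicCompletion K))).toAffine.Point}
    (hg : ∀ σ τ, g (σ * τ) = g σ + WeierstrassCurve.Affine.Point.map (W' := X) ((absoluteGaloisGroup.toAlgEquiv (v.adicCompletion K) (σ) : AlgebraicClosure (v.adicCompletion K) ≃ₐ[v.adicCompletion K] AlgebraicClosure (v.adicCompletion K)) : AlgebraicClosure (v.adicCompletion K) →ₐ[v.adicCompletion K] AlgebraicClosure (v.adicCompletion K)) (g τ)) : g 1 = 0 := by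
  have h := hg 1 1
  rw [mul_one, map_gal_one] at h
  simpa using h

/-- A crossed homomorphism at an inverse: `g σ = 0 → g σ⁻¹ = 0`. [folklore] -/
theorem cocycle_apply_inv_eq_zero {g : absoluteGaloisGroup (v.adicCompletion K) → (X.baseChange (AlgebraicClosure (v.adicCompletion K))).toAffine.Point}
    (hg : ∀ σ τ, g (σ * τ) = g σ + WeierstrassCurve.Affine.Point.map (W' := X) ((absoluteGaloisGroup.toAlgEquiv (v.adicCompletion K) (σ) : AlgebraicClosure (v.adicCompletion K) ≃ₐ[v.adicCompletion K] AlgebraicClosure (v.adicCompletion K)) : AlgebraicClosure (v.adicCompletion K) →ₐ[v.adicCompletion K] AlgebraicClosure (v.adicCompletion K)) (g τ)) {σ : absoluteGaloisGroup (v.adicCompletion K)}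
    (hσ : g σ = 0) : g σ⁻¹ = 0 := by
  have h := hg σ⁻¹ σ
  rw [inv_mul_cancel, cocycle_apply_one hg, hσ, map_zero, add_zero] at h
  exact h.symm

/-- **Iteration**: `g (φᵏ) = Σ_{j<k} φʲ · g φ` for a crossed homomorphism `g`. [folklore] -/
theorem cocycle_apply_pow {g : absoluteGaloisGroup (v.adicCompletion K) → (X.baseChange (AlgebraicClosure (v.adicCompletion K))).toAffine.Point}
    (hg : ∀ σ τ, g (σ * τ) = g σ + WeierstrassCurve.Affine.Point.map (W' := X) ((absoluteGaloisGroup.toAlgEquiv (v.adicCompletion K) (σ) : AlgebraicClosure (v.adicCompletion K) ≃ₐ[v.adicCompletion K] AlgebraicClosure (v.adicCompletion K)) : AlgebraicClosure (v.adicCompletion K) →ₐ[v.adicCompletion K] AlgebraicClosure (v.adicCompletion K)) (g τ)) (φ : absoluteGaloisGroup (v.adicCompletion K)) (k : ℕ) :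
    g (φ ^ k) = ∑ j ∈ Finset.range k, WeierstrassCurve.Affine.Point.map (W' := X) ((absoluteGaloisGroup.toAlgEquiv (v.adicCompletion K) (φ ^ j) : AlgebraicClosure (v.adicCompletion K) ≃ₐ[v.adicCompletion K] AlgebraicClosure (v.adicCompletion K)) : AlgebraicClosure (v.adicCompletion K) →ₐ[v.adicCompletion K] AlgebraicClosure (v.adicCompletion K)) (g φ) := by
  induction k with
  | zero => rw [pow_zero, cocycle_apply_one hg, Finset.sum_range_zero]
  | succ k ih => rw [pow_succ, hg, ih, Finset.sum_range_succ]

/-- Subtracting a coboundary `σ ↦ σP - P` from a crossed homomorphism gives a crossed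
homomorphism. [folklore] -/
theorem cocycle_sub_coboundary {g : absoluteGaloisGroup (v.adicCompletion K) → (X.baseChange (AlgebraicClosure (v.adicCompletion K))).toAffine.Point}
    (hg : ∀ σ τ, g (σ * τ) = g σ + WeierstrassCurve.Affine.Point.map (W' := X) ((absoluteGaloisGroup.toAlgEquiv (v.adicCompletion K) (σ) : AlgebraicClosure (v.adicCompletion K) ≃ₐ[v.adicCompletion K] AlgebraicClosure (v.adicCompletion K)) : AlgebraicClosure (v.adicCompletion K) →ₐ[v.adicCompletion K] AlgebraicClosure (v.adicCompletion K)) (g τ))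
    (P : (X.baseChange (AlgebraicClosure (v.adicCompletion K))).toAffine.Point) :
    ∀ σ τ, (g (σ * τ) - (WeierstrassCurve.Affine.Point.map (W' := X) ((absoluteGaloisGroup.toAlgEquiv (v.adicCompletion K) (σ * τ) : AlgebraicClosure (v.adicCompletion K) ≃ₐ[v.adicCompletion K] AlgebraicClosure (v.adicCompletion K)) : AlgebraicClosure (v.adicCompletion K) →ₐ[v.adicCompletion K] AlgebraicClosure (v.adicCompletion K)) P - P)) =
      (g σ - (WeierstrassCurve.Affine.Point.map (W' := X) ((absoluteGaloisGroup.toAlgEquiv (v.adicCompletion K) (σ) : AlgebraicClosure (v.adicCompletion K) ≃ₐ[v.adicCompletion K] AlgebraicClosure (v.adicCompletion K)) : AlgebraicClosure (v.adicCompletion K) →ₐ[v.adicCompletion K] AlgebraicClosure (v.adicCompletion K)) P - P)) + WeierstrassCurve.Affine.Point.map (W' := X) ((absoluteGaloisGroup.toAlgEquiv (v.adicCompletion K) (σ) : AlgebraicClosure (v.adicCompletion K) ≃ₐ[v.adicCompletion K] AlgebraicClosure (v.adicCompletion K)) : AlgebraicClosure (v.adicCompletion K) →ₐ[v.adicCompletion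 K] AlgebraicClosure (v.adicCompletion K)) (g τ - (WeierstrassCurve.Affine.Point.map (W' := X) ((absoluteGaloisGroup.toAlgEquiv (v.adicCompletion K) (τ) : AlgebraicClosure (v.adicCompletion K) ≃ₐ[v.adicCompletion K] AlgebraicClosure (v.adicCompletion K)) : AlgebraicClosure (v.adicCompletion K) →ₐ[v.adicCompletion K] AlgebraicClosure (v.adicCompletion K)) P - P)) := by
  intro σ τ
  rw [hg, map_gal_mul, map_sub, map_sub]
  abel

/-- The zero set of a crossed homomorphism is a subgroup. [folklore] -/
theorem exists_subgroup_coe_eq_setOf {g : absoluteGaloisGroup (v.adicCompletion K) → (X.baseChange (AlgebraicClosure (v.adicCompletion K))).toAffine.Point}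
    (hg : ∀ σ τ, g (σ * τ) = g σ + WeierstrassCurve.Affine.Point.map (W' := X) ((absoluteGaloisGroup.toAlgEquiv (v.adicCompletion K) (σ) : AlgebraicClosure (v.adicCompletion K) ≃ₐ[v.adicCompletion K] AlgebraicClosure (v.adicCompletion K)) : AlgebraicClosure (v.adicCompletion K) →ₐ[v.adicCompletion K] AlgebraicClosure (v.adicCompletion K)) (g τ)) :
    ∃ U : Subgroup (absoluteGaloisGroup (v.adicCompletion K)), (U : Set (absoluteGaloisGroup (v.adicCompletion K))) = {σ | g σ = 0} :=
  ⟨{ carrier := {σ | g σ = 0}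
     one_mem' := cocycle_apply_one hg
     mul_mem' := fun {σ τ} hσ hτ ↦ by
       simp only [Set.mem_setOf_eq] at hσ hτ ⊢
       rw [hg, hσ, hτ, map_zero, add_zero]
     inv_mem' := fun {σ} hσ ↦ cocycle_apply_inv_eq_zero hg hσ }, rfl⟩

/-- **The zero set of a crossed homomorphism is open as soon as it is a neighbourhood of `1`**
(it is then a union of left translates of that neighbourhood). [folklore] -/
theorem isOpen_setOf_eq_zero_of_mem_nhds {g : absoluteGaloisGroup (v.adicCompletion K) → (X.baseChange (AlgebraicClosure (v.adicCompletion K))).toAffine.Point}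
    (hg : ∀ σ τ, g (σ * τ) = g σ + WeierstrassCurve.Affine.Point.map (W' := X) ((absoluteGaloisGroup.toAlgEquiv (v.adicCompletion K) (σ) : AlgebraicClosure (v.adicCompletion K) ≃ₐ[v.adicCompletion K] AlgebraicClosure (v.adicCompletion K)) : AlgebraicClosure (v.adicCompletion K) →ₐ[v.adicCompletion K] AlgebraicClosure (v.adicCompletion K)) (g τ))
    (h1 : {σ | g σ = 0} ∈ 𝓝 (1 : absoluteGaloisGroup (v.adicCompletion K))) : IsOpen {σ | g σ = 0} := by
  rw [isOpen_iff_mem_nhds]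
  intro σ₀ hσ₀
  rw [← map_mul_left_nhds_one, Filter.mem_map]
  refine Filter.mem_of_superset h1 fun τ hτ ↦ ?_
  simp only [Set.mem_setOf_eq, Set.mem_preimage] at hσ₀ hτ ⊢
  rw [hg, hσ₀, hτ, map_zero, add_zero]

/-- The zero set of `g - ∂P` is a neighbourhood of `1` if that of `g` is open: it contains the
open set `{g = 0} ∩ Stab(P)` (`isOpen_setOf_map_eq`). [folklore] -/
theorem setOf_sub_coboundary_eq_zero_mem_nhds {g : absoluteGaloisGroup (v.adicCompletion K) → (X.baseChange (AlgebraicClosure (v.adicCompletion K))).toAffine.Point}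
    (hg : ∀ σ τ, g (σ * τ) = g σ + WeierstrassCurve.Affine.Point.map (W' := X) ((absoluteGaloisGroup.toAlgEquiv (v.adicCompletion K) (σ) : AlgebraicClosure (v.adicCompletion K) ≃ₐ[v.adicCompletion K] AlgebraicClosure (v.adicCompletion K)) : AlgebraicClosure (v.adicCompletion K) →ₐ[v.adicCompletion K] AlgebraicClosure (v.adicCompletion K)) (g τ))
    (hopen : IsOpen {σ | g σ = 0}) (P : (X.baseChange (AlgebraicClosure (v.adicCompletion K))).toAffine.Point) :
    {σ | g σ - (WeierstrassCurve.Affine.Point.map (W' := X) ((absoluteGaloisGroup.toAlgEquiv (v.adicCompletion K) (σ) : AlgebraicClosure (v.adicCompletion K) ≃ₐ[v.adicCompletion K] AlgebraicClosure (v.adicCompletion K)) : AlgebraicClosure (v.adicCompletion K) →ₐ[v.adicCompletion K] AlgebraicClosure (v.adicCompletion K)) P - P) = 0} ∈ 𝓝 (1 : absoluteGaloisGroup (v.adicCompletion K)) := by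
  have h1 : {σ | g σ = 0} ∈ 𝓝 (1 : absoluteGaloisGroup (v.adicCompletion K)) := hopen.mem_nhds (cocycle_apply_one hg)
  have h2 : {σ : absoluteGaloisGroup (v.adicCompletion K) | WeierstrassCurve.Affine.Point.map (W' := X) ((absoluteGaloisGroup.toAlgEquiv (v.adicCompletion K) (σ) : AlgebraicClosure (v.adicCompletion K) ≃ₐ[v.adicCompletion K] AlgebraicClosure (v.adicCompletion K)) : AlgebraicClosure (v.adicCompletion K) →ₐ[v.adicCompletion K] AlgebraicClosure (v.adicCompletion K)) P = P} ∈ 𝓝 (1 : absoluteGaloisGroup (v.adicCompletion K)) :=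
    (isOpen_setOf_map_eq X P).mem_nhds (map_gal_one P)
  refine Filter.mem_of_superset (Filter.inter_mem h1 h2) fun σ hσ ↦ ?_
  simp only [Set.mem_inter_iff, Set.mem_setOf_eq] at hσ ⊢
  rw [hσ.1, hσ.2, sub_self, sub_zero]

/-- Hence `g - ∂P` has open zero set if `g` has. [folklore] -/
theorem isOpen_setOf_sub_coboundary_eq_zero {g : absoluteGaloisGroup (v.adicCompletion K) → (X.baseChange (AlgebraicClosure (v.adicCompletion K))).toAffine.Point}
    (hg : ∀ σ τ, g (σ * τ) = g σ + WeierstrassCurve.Affine.Point.map (W' := X) ((absoluteGaloisGroup.toAlgEquiv (v.adicCompletion K) (σ) : AlgebraicClosure (v.adicCompletion K) ≃ₐ[v.adicCompletion K] AlgebraicClosure (v.adicCompletion K)) : AlgebraicClosure (v.adicCompletion K) →ₐ[v.adicCompletion K] AlgebraicClosure (v.adicCompletion K)) (g τ))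
    (hopen : IsOpen {σ | g σ = 0}) (P : (X.baseChange (AlgebraicClosure (v.adicCompletion K))).toAffine.Point) :
    IsOpen {σ | g σ - (WeierstrassCurve.Affine.Point.map (W' := X) ((absoluteGaloisGroup.toAlgEquiv (v.adicCompletion K) (σ) : AlgebraicClosure (v.adicCompletion K) ≃ₐ[v.adicCompletion K] AlgebraicClosure (v.adicCompletion K)) : AlgebraicClosure (v.adicCompletion K) →ₐ[v.adicCompletion K] AlgebraicClosure (v.adicCompletion K)) P - P) = 0} :=
  isOpen_setOf_eq_zero_of_mem_nhds (g := fun σ ↦ g σ - (WeierstrassCurve.Affine.Point.map (W' := X) ((absoluteGaloisGroup.toAlgEquiv (v.adicCompletion K) (σ) : AlgebraicClosure (v.adicCompletion K) ≃ₐ[v.adicCompletion K] AlgebraicClosure (v.adicCompletion K)) : AlgebraicClosure (v.adicCompletion K) →ₐ[v.adicCompletion K] AlgebraicClosure (v.adicCompletion K)) P - P)) (cocycle_sub_coboundary hg P)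
    (setOf_sub_coboundary_eq_zero_mem_nhds hg hopen P)

/-- Points with coordinates in an intermediate field `K_n` are in the range of
`map (K_n → K̄_v)`. [folklore] -/
theorem mem_range_map_val {Kn : IntermediateField (v.adicCompletion K) (AlgebraicClosure (v.adicCompletion K))} {x y : (AlgebraicClosure (v.adicCompletion K))} (h : (X.baseChange (AlgebraicClosure (v.adicCompletion K))).toAffine.Nonsingular x y)
    (hx : x ∈ Kn) (hy : y ∈ Kn) :
    (Affine.Point.some x y h : (X.baseChange (AlgebraicClosure (v.adicCompletion K))).toAffine.Point) ∈
      (Affine.Point.map (W' := X) (IntermediateField.val Kn)).range := by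
  have h' : (X.baseChange Kn).toAffine.Nonsingular ⟨x, hx⟩ ⟨y, hy⟩ :=
    (Affine.baseChange_nonsingular X.toAffine (IntermediateField.val Kn).injective
      (⟨x, hx⟩ : Kn) (⟨y, hy⟩ : Kn)).mp h
  exact ⟨.some _ _ h', rfl⟩

/-- A point in the range of `map (K_n → K̄_v)` is fixed by every algebra endomorphism fixing
`K_n` pointwise. [folklore] -/
theorem map_eq_self_of_mem_range {Kn : IntermediateField (v.adicCompletion K) (AlgebraicClosure (v.adicCompletion K))} (f : (AlgebraicClosure (v.adicCompletion K)) →ₐ[(v.adicCompletion K)] (AlgebraicClosure (v.adicCompletion K)))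
    (hf : ∀ x ∈ Kn, f x = x) {P : (X.baseChange (AlgebraicClosure (v.adicCompletion K))).toAffine.Point}
    (hP : P ∈ (Affine.Point.map (W' := X) (IntermediateField.val Kn)).range) :
    Affine.Point.map (W' := X) f P = P := by
  obtain ⟨P', rfl⟩ := hP
  rw [Affine.Point.map_map]
  have : f.comp (IntermediateField.val Kn) = IntermediateField.val Kn :=
    AlgHom.ext fun x ↦ hf x x.2
  rw [this]

end Cocycle

/-! ## The core theorem: crossed homomorphisms vanishing on inertia are coboundaries -/

section Main

variable (W : WeierstrassCurve K)
  (hw : ∀ x, (w x : ℝ) = spectralNorm (v.adicCompletion K) (AlgebraicClosure (v.adicCompletion K)) x)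


include hw in
set_option maxHeartbeats 1600000 in
/-- **Crossed homomorphisms `Γ_{K_v} → E(K̄_v)` with open zero set vanishing on the inertia group
are principal** (good reduction): the cocycle form of Milne, *ADT*, Prop. I.3.8,
`H¹(K_v^nr/K_v, E(K_v^nr)) = 0`, for the good model `V = M ⊗ K̄_v`. Proof (Lang–Tate / Milne
p. 47): with a local arithmetic Frobenius `F`, Lang's theorem and Hensel
(`exists_lift_sub_mem_kernel`) give an `I`-invariant `b` with `m₁ = g F - (F b - b) ∈ V₁`;
`g₁ = g - ∂b` still vanishes on `I`, so `m₁` is `I`-invariant with coordinates in `K_v^nr`, in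
fact in a finite layer `K_n = K_v(ζ_{qⁿ-1})` which may be taken with `g₁(Fⁿ) = 0` (open zero
set, `Γ` profinite); then `Σ_{j<n} Fʲ m₁ = g₁(Fⁿ) = O` and the successive approximation
`FormalGroupChart.exists_map_sub_eq_of_sum_eq_zero` (graded Hilbert 90 `exists_frob_sub_sub_lt_one`,
Hensel lifts `exists_mem_kernel_zCoord_eq`, completeness of `K_n`) gives `Q ∈ V₁(K_n)` with
`F Q - Q = m₁`; `g₂ = g₁ - ∂Q` vanishes on `I` and at `F`, and its zero set is an open subgroup,
hence everything (`eq_top_of_isOpen_of_frobenius_mem_of_inertia_le`: `⟨F, I⟩` is dense).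
[cite: MilneADT2006, Ch. I Prop. 3.8 (proof)] -/
theorem exists_eq_map_sub_of_cocycle [W.IsElliptic] (hv : W.HasGoodReductionAt v)
    {𝔐 : Ideal v.localAbsIntegers} (h𝔐 : 𝔐 ∈ v.localPrimesAbove)
    [hV : ((((W.localMinimalIntegralModel v).map (algebraMap (v.adicCompletionIntegers K) (v.adicCompletion K))).baseChange (AlgebraicClosure (v.adicCompletion K)))).IsIntegral w.integer]
    (g : absoluteGaloisGroup (v.adicCompletion K) → ((((W.localMinimalIntegralModel v).map (algebraMap (v.adicCompletionIntegers K) (v.adicCompletion K))).baseChange (AlgebraicClosure (v.adicCompletion K)))).toAffine.Point)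
    (hg : ∀ σ τ, g (σ * τ) = g σ + WeierstrassCurve.Affine.Point.map (W' := (W.localMinimalIntegralModel v).map (algebraMap (v.adicCompletionIntegers K) (v.adicCompletion K))) ((absoluteGaloisGroup.toAlgEquiv (v.adicCompletion K) (σ) : AlgebraicClosure (v.adicCompletion K) ≃ₐ[v.adicCompletion K] AlgebraicClosure (v.adicCompletion K)) : AlgebraicClosure (v.adicCompletion K) →ₐ[v.adicCompletion K] AlgebraicClosure (v.adicCompletion K)) (g τ))
    (hopen : IsOpen {σ | g σ = 0})
    (hI : ∀ τ ∈ 𝔐.inertia (absoluteGaloisGroup (v.adicCompletion K)), g τ = 0) :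
    ∃ P : ((((W.localMinimalIntegralModel v).map (algebraMap (v.adicCompletionIntegers K) (v.adicCompletion K))).baseChange (AlgebraicClosure (v.adicCompletion K)))).toAffine.Point, ∀ σ, g σ = WeierstrassCurve.Affine.Point.map (W' := (W.localMinimalIntegralModel v).map (algebraMap (v.adicCompletionIntegers K) (v.adicCompletion K))) ((absoluteGaloisGroup.toAlgEquiv (v.adicCompletion K) (σ) : AlgebraicClosure (v.adicCompletion K) ≃ₐ[v.adicCompletion K] AlgebraicClosure (v.adicCompletion K)) : AlgebraicClosure (v.adicCompletion K) →ₐ[v.adicCompletion K] AlgebraicClosure (v.adicCompletion K)) P - P := by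
  have hq2 := two_le_natCard_residueField (K := K) (v := v)
  haveI hVell : ((((W.localMinimalIntegralModel v).map (algebraMap (v.adicCompletionIntegers K) (v.adicCompletion K))).baseChange (AlgebraicClosure (v.adicCompletion K)))).IsElliptic := by
    rw [isElliptic_iff, baseChange, map_Δ, map_Δ]
    exact ((isUnit_Δ_localMinimalIntegralModel hv).map _).map _
  haveI hInormal : (𝔐.inertia (absoluteGaloisGroup (v.adicCompletion K))).Normal := inertia_normal_of_mem_localPrimesAbove v h𝔐
  -- a local arithmetic Frobenius `F`
  obtain ⟨F, hF⟩ := exists_isArithFrobAt_localAbsIntegers (v := v) h𝔐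
  have hφq : ∀ z : (AlgebraicClosure (v.adicCompletion K)), w z ≤ 1 → w ((absoluteGaloisGroup.toAlgEquiv (v.adicCompletion K)) F z - z ^ (Nat.card (IsLocalRing.ResidueField (v.adicCompletionIntegers K)))) < 1 :=
    fun z hz ↦ spectralValuation_frobenius_sub_pow_lt_one hw h𝔐 hF hz
  have hFw : ∀ z : (AlgebraicClosure (v.adicCompletion K)), w ((absoluteGaloisGroup.toAlgEquiv (v.adicCompletion K)) F z) = w z := fun z ↦ spectralValuation_smul hw F z
  have hσw : ∀ (σ : absoluteGaloisGroup (v.adicCompletion K)) (z : (AlgebraicClosure (v.adicCompletion K))), w ((absoluteGaloisGroup.toAlgEquiv (v.adicCompletion K)) σ z) = w z :=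
    fun σ z ↦ spectralValuation_smul hw σ z
  -- Step 1 (Lang + Hensel): `m₁ = g F - (F b - b) ∈ V₁` with `b` fixed by `I`
  obtain ⟨b, hbI, hm₁⟩ := exists_lift_sub_mem_kernel (W := W) hw hv h𝔐 hφq (g F)
  set g₁ : absoluteGaloisGroup (v.adicCompletion K) → ((((W.localMinimalIntegralModel v).map (algebraMap (v.adicCompletionIntegers K) (v.adicCompletion K))).baseChange (AlgebraicClosure (v.adicCompletion K)))).toAffine.Point := fun σ ↦ g σ - (WeierstrassCurve.Affine.Point.map (W' := (W.localMinimalIntegralModel v).map (algebraMap (v.adicCompletionIntegers K) (v.adicCompletion K))) ((absoluteGaloisGroup.toAlgEquiv (v.adicCompletion K) (σ) : AlgebraicClosure (v.adicCompletion K) ≃ₐ[v.adicCompletion K] AlgebraicClosure (v.adicCompletion K)) : AlgebraicClosure (v.adicCompletion K) →ₐ[v.adicCompletion K] AlgebraicClosure (v.adicCompletion K)) b - b) with hg₁def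
  have hg₁ : ∀ σ τ, g₁ (σ * τ) = g₁ σ + WeierstrassCurve.Affine.Point.map (W' := (W.localMinimalIntegralModel v).map (algebraMap (v.adicCompletionIntegers K) (v.adicCompletion K))) ((absoluteGaloisGroup.toAlgEquiv (v.adicCompletion K) (σ) : AlgebraicClosure (v.adicCompletion K) ≃ₐ[v.adicCompletion K] AlgebraicClosure (v.adicCompletion K)) : AlgebraicClosure (v.adicCompletion K) →ₐ[v.adicCompletion K] AlgebraicClosure (v.adicCompletion K)) (g₁ τ) := cocycle_sub_coboundary hg b
  have hg₁I : ∀ τ ∈ 𝔐.inertia (absoluteGaloisGroup (v.adicCompletion K)), g₁ τ = 0 := fun τ hτ ↦ by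
    simp only [hg₁def, hI τ hτ, hbI τ hτ, sub_self]
  have hg₁open : IsOpen {σ | g₁ σ = 0} := isOpen_setOf_sub_coboundary_eq_zero hg hopen b
  have hm₁K : g₁ F ∈ kernel w (((W.localMinimalIntegralModel v).map (algebraMap (v.adicCompletionIntegers K) (v.adicCompletion K))).baseChange (AlgebraicClosure (v.adicCompletion K))) := hm₁
  -- `m₁` is fixed by `I`
  have hm₁I : ∀ τ ∈ 𝔐.inertia (absoluteGaloisGroup (v.adicCompletion K)), WeierstrassCurve.Affine.Point.map (W' := (W.localMinimalIntegralModel v).map (algebraMap (v.adicCompletionIntegers K) (v.adicCompletion K))) ((absoluteGaloisGroup.toAlgEquiv (v.adicCompletion K) (τ) : AlgebraicClosure (v.adicCompletion K) ≃ₐ[v.adicCompletion K] AlgebraicClosure (v.adicCompletion K)) : AlgebraicClosure (v.adicCompletion K) →ₐ[v.adicCompletion K] AlgebraicClosure (v.adicCompletion K)) (g₁ F) = g₁ F := by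
    intro τ hτ
    have hτ' : F⁻¹ * τ * F ∈ 𝔐.inertia (absoluteGaloisGroup (v.adicCompletion K)) := by
      have := hInormal.conj_mem τ hτ F⁻¹
      rwa [inv_inv] at this
    have h1 : g₁ (τ * F) = WeierstrassCurve.Affine.Point.map (W' := (W.localMinimalIntegralModel v).map (algebraMap (v.adicCompletionIntegers K) (v.adicCompletion K))) ((absoluteGaloisGroup.toAlgEquiv (v.adicCompletion K) (τ) : AlgebraicClosure (v.adicCompletion K) ≃ₐ[v.adicCompletion K] AlgebraicClosure (v.adicCompletion K)) : AlgebraicClosure (v.adicCompletion K) →ₐ[v.adicCompletion K] AlgebraicClosure (v.adicCompletion K)) (g₁ F) := by rw [hg₁, hg₁I τ hτ, zero_add]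
    have h2 : g₁ (F * (F⁻¹ * τ * F)) = g₁ F := by rw [hg₁, hg₁I _ hτ', map_zero, add_zero]
    rw [← h1, show τ * F = F * (F⁻¹ * τ * F) by group, h2]
  -- the coordinates of `m₁` lie in `K_v^nr`
  set m₁ := g₁ F with hm₁def
  have hcoordI : ∀ z : (AlgebraicClosure (v.adicCompletion K)), (∀ τ ∈ 𝔐.inertia (absoluteGaloisGroup (v.adicCompletion K)), (absoluteGaloisGroup.toAlgEquiv (v.adicCompletion K)) τ z = z) →
      z ∈ maxUnramified (v.adicCompletion K) := fun z hz ↦ (mem_maxUnramified_iff_forall_inertia hw h𝔐).mpr hz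
  -- Step 2: the level `n`
  -- (a) an open normal subgroup of finite index inside the zero set of `g₁`
  have hS₁ : {σ | g₁ σ = 0} ∈ 𝓝 (1 : absoluteGaloisGroup (v.adicCompletion K)) := hg₁open.mem_nhds (cocycle_apply_one hg₁)
  haveI := isGalois_algebraicClosure_adicCompletion (v := v)
  obtain ⟨L₀, hL₀fin, hL₀normal, hL₀sub⟩ :=
    (krullTopology_mem_nhds_one_iff_of_normal (v.adicCompletion K) (AlgebraicClosure (v.adicCompletion K)) {σ | g₁ σ = 0}).mp hS₁
  haveI := hL₀fin
  haveI := hL₀normal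
  set m₀ : ℕ := orderOf (AlgEquiv.restrictNormalHom L₀ ((absoluteGaloisGroup.toAlgEquiv (v.adicCompletion K)) F)) with hm₀def
  have hm₀pos : 0 < m₀ := orderOf_pos _
  have hFpow : ∀ k : ℕ, g₁ (F ^ (m₀ * k)) = 0 := by
    intro k
    apply hL₀sub
    change ((absoluteGaloisGroup.toAlgEquiv (v.adicCompletion K)) (F ^ (m₀ * k)) : (AlgebraicClosure (v.adicCompletion K)) ≃ₐ[(v.adicCompletion K)] (AlgebraicClosure (v.adicCompletion K))) ∈ (L₀.fixingSubgroup : Set ((AlgebraicClosure (v.adicCompletion K)) ≃ₐ[(v.adicCompletion K)] (AlgebraicClosure (v.adicCompletion K))))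
    rw [SetLike.mem_coe, ← IntermediateField.restrictNormalHom_ker, MonoidHom.mem_ker, map_pow, map_pow,
      pow_mul, pow_orderOf_eq_one, one_pow]
  -- (b) the roots of unity generating a field containing the coordinates of `m₁`
  obtain ⟨T, hTsub, hTgen⟩ : ∃ T : Finset (AlgebraicClosure (v.adicCompletion K)), (↑T : Set (AlgebraicClosure (v.adicCompletion K))) ⊆ primeToPRootsOfUnity (v.adicCompletion K) ∧
      ∀ z : (AlgebraicClosure (v.adicCompletion K)), (∃ x y h, m₁ = .some x y h ∧ (z = x ∨ z = y)) → z ∈ IntermediateField.adjoin (v.adicCompletion K) (↑T : Set (AlgebraicClosure (v.adicCompletion K))) := by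
    rcases hm : m₁ with _ | ⟨x₁, y₁, h₁⟩
    · exact ⟨∅, by simp, fun z ⟨x, y, h, he, _⟩ ↦ by cases he⟩
    · have hfix : ∀ τ ∈ 𝔐.inertia (absoluteGaloisGroup (v.adicCompletion K)), (absoluteGaloisGroup.toAlgEquiv (v.adicCompletion K)) τ x₁ = x₁ ∧ (absoluteGaloisGroup.toAlgEquiv (v.adicCompletion K)) τ y₁ = y₁ := by
        intro τ hτ
        have := hm₁I τ hτ
        rw [hm, Affine.Point.map_some] at this
        simpa [Affine.Point.some.injEq] using this
      obtain ⟨T₁, hT₁, hx₁⟩ := IntermediateField.exists_finset_of_mem_adjoin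
        (hcoordI x₁ fun τ hτ ↦ (hfix τ hτ).1)
      obtain ⟨T₂, hT₂, hy₁⟩ := IntermediateField.exists_finset_of_mem_adjoin
        (hcoordI y₁ fun τ hτ ↦ (hfix τ hτ).2)
      refine ⟨T₁ ∪ T₂, by rw [Finset.coe_union]; exact Set.union_subset hT₁ hT₂, ?_⟩
      rintro z ⟨x, y, h, he, hz⟩
      simp only [Affine.Point.some.injEq] at he
      obtain ⟨rfl, rfl⟩ := he
      rw [Finset.coe_union]
      rcases hz with rfl | rfl
      · exact IntermediateField.adjoin.mono _ _ _ Set.subset_union_left hx₁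
      · exact IntermediateField.adjoin.mono _ _ _ Set.subset_union_right hy₁
  have hTroot : ∀ ζ ∈ T, ∃ N : ℕ, IsUnit ((N : ℕ) : 𝒪[(v.adicCompletion K)]) ∧ ζ ^ N = 1 := fun ζ hζ ↦ hTsub hζ
  choose! Nf hNf using hTroot
  set N₀ : ℕ := ∏ ζ ∈ T, Nf ζ with hN₀def
  have hN₀unit : IsUnit ((N₀ : ℕ) : 𝒪[(v.adicCompletion K)]) := by
    rw [hN₀def, Nat.cast_prod]
    exact IsUnit.prod_iff.mpr fun ζ hζ ↦ (hNf ζ hζ).1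
  have hTpow : ∀ ζ ∈ T, ζ ^ N₀ = 1 := fun ζ hζ ↦ by
    obtain ⟨c, hc⟩ := Finset.dvd_prod_of_mem Nf hζ
    rw [hN₀def, hc, pow_mul, (hNf ζ hζ).2, one_pow]
  -- (c) `q` is prime to `N₀`, so `N₀ ∣ q^t - 1` for `t = φ(N₀)`
  obtain ⟨hN₀pos, hpN₀⟩ := pos_and_not_ringChar_dvd_of_isUnit_natCast hN₀unit
  have hcop : Nat.Coprime (Nat.card (IsLocalRing.ResidueField (v.adicCompletionIntegers K))) N₀ := by
    obtain ⟨f, -, hf⟩ := residueFieldCard_eq_pow_ringChar (F := (v.adicCompletion K))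
    rw [WeierstrassCurve.natCard_residueField_eq_residueCard,
      ← Literature.NumberTheory.Automorphic.residueFieldCard_adicCompletion_eq K v, hf]
    refine Nat.Coprime.pow_left f ?_
    letI := Fintype.ofFinite 𝓀[(v.adicCompletion K)]
    obtain ⟨_, hp, _⟩ := FiniteField.card 𝓀[(v.adicCompletion K)] (ringChar 𝓀[(v.adicCompletion K)])
    exact (Nat.Prime.coprime_iff_not_dvd hp).mpr hpN₀
  set t : ℕ := Nat.totient N₀ with htdef
  have htpos : 0 < t := Nat.totient_pos.mpr hN₀pos
  set n : ℕ := m₀ * t with hndef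
  have hn : n ≠ 0 := Nat.mul_ne_zero hm₀pos.ne' htpos.ne'
  have h1qn : 1 ≤ (Nat.card (IsLocalRing.ResidueField (v.adicCompletionIntegers K))) ^ n := Nat.one_le_pow _ _ (by omega)
  have hN₀dvd : N₀ ∣ (Nat.card (IsLocalRing.ResidueField (v.adicCompletionIntegers K))) ^ n - 1 := by
    have h1 : (Nat.card (IsLocalRing.ResidueField (v.adicCompletionIntegers K))) ^ t ≡ 1 [MOD N₀] := Nat.ModEq.pow_totient hcop
    have h2 : (Nat.card (IsLocalRing.ResidueField (v.adicCompletionIntegers K))) ^ n ≡ 1 [MOD N₀] := by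
      rw [hndef, mul_comm, pow_mul]
      simpa using h1.pow m₀
    exact (Nat.modEq_iff_dvd' h1qn).mp h2.symm
  have hg₁Fn : g₁ (F ^ n) = 0 := hFpow t
  -- (d) the layer `K_n = K_v(ζ)`, `ζ` a primitive `(qⁿ - 1)`-th root of unity
  obtain ⟨ζ, hζ⟩ := exists_isPrimitiveRoot_residueCard_pow_sub_one (v := v) hn
  have hm0 : (Nat.card (IsLocalRing.ResidueField (v.adicCompletionIntegers K))) ^ n - 1 ≠ 0 := by
    have : 1 < (Nat.card (IsLocalRing.ResidueField (v.adicCompletionIntegers K))) ^ n := Nat.one_lt_pow hn (by omega)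
    omega
  have hmw : w (((Nat.card (IsLocalRing.ResidueField (v.adicCompletionIntegers K))) ^ n - 1 : ℕ) : (AlgebraicClosure (v.adicCompletion K))) = 1 := spectralValuation_natCast_residueCard_pow_sub_one hw hn
  have hζpow : ζ ^ ((Nat.card (IsLocalRing.ResidueField (v.adicCompletionIntegers K))) ^ n - 1) = 1 := hζ.pow_eq_one
  set Kn : IntermediateField (v.adicCompletion K) (AlgebraicClosure (v.adicCompletion K)) := IntermediateField.adjoin (v.adicCompletion K) {ζ} with hKndef
  have hTKn : ∀ z ∈ T, z ∈ Kn := by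
    intro z hz
    haveI : NeZero ((Nat.card (IsLocalRing.ResidueField (v.adicCompletionIntegers K))) ^ n - 1) := ⟨hm0⟩
    have hz1 : z ^ ((Nat.card (IsLocalRing.ResidueField (v.adicCompletionIntegers K))) ^ n - 1) = 1 := by
      obtain ⟨c, hc⟩ := hN₀dvd
      rw [hc, pow_mul, hTpow z hz, one_pow]
    obtain ⟨i, -, rfl⟩ := hζ.eq_pow_of_pow_eq_one hz1
    exact pow_mem (IntermediateField.mem_adjoin_simple_self (v.adicCompletion K) ζ) i
  have hadjT : IntermediateField.adjoin (v.adicCompletion K) (↑T : Set (AlgebraicClosure (v.adicCompletion K))) ≤ Kn :=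
    IntermediateField.adjoin_le_iff.mpr fun z hz ↦ hTKn z hz
  have hm₁R : m₁ ∈ (Affine.Point.map (W' := (W.localMinimalIntegralModel v).map (algebraMap (v.adicCompletionIntegers K) (v.adicCompletion K)))
      (IntermediateField.val Kn)).range := by
    rcases hm : m₁ with _ | ⟨x₁, y₁, h₁⟩
    · exact ⟨0, by rw [map_zero]; rfl⟩
    · exact mem_range_map_val h₁ (hadjT (hTgen x₁ ⟨x₁, y₁, h₁, hm, Or.inl rfl⟩))
        (hadjT (hTgen y₁ ⟨x₁, y₁, h₁, hm, Or.inr rfl⟩))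
  -- the Frobenius on the layer
  have hFζ : F • ζ = ζ ^ (Nat.card (IsLocalRing.ResidueField (v.adicCompletionIntegers K))) := frobenius_smul_eq_pow_of_pow_eq_one hw h𝔐 hF hm0 hmw hζpow
  have hFK : ∀ x : Kn, (((absoluteGaloisGroup.toAlgEquiv (v.adicCompletion K)) F : (AlgebraicClosure (v.adicCompletion K)) ≃ₐ[(v.adicCompletion K)] (AlgebraicClosure (v.adicCompletion K))) : (AlgebraicClosure (v.adicCompletion K)) →ₐ[(v.adicCompletion K)] (AlgebraicClosure (v.adicCompletion K))) x ∈ Kn := fun x ↦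
    smul_mem_adjoin_of_smul_eq_pow hFζ x.2
  have hFnζ : F ^ n • ζ = ζ := (frobenius_pow_smul_eq_self_iff hw h𝔐 hF hn hζ n).mpr dvd_rfl
  have hFn : ∀ x : Kn, ((((absoluteGaloisGroup.toAlgEquiv (v.adicCompletion K)) F : (AlgebraicClosure (v.adicCompletion K)) ≃ₐ[(v.adicCompletion K)] (AlgebraicClosure (v.adicCompletion K))) : (AlgebraicClosure (v.adicCompletion K)) →ₐ[(v.adicCompletion K)] (AlgebraicClosure (v.adicCompletion K))) ^ n) x = x := fun x ↦ by
    rw [coe_gal_pow]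
    exact algHom_apply_eq_self_of_mem_adjoin hm0 hζpow _ hFnζ x.2
  -- Step 3: successive approximation on `V₁(K_n)`
  obtain ⟨ϖ, hϖ⟩ := IsDiscreteValuationRing.exists_irreducible (v.adicCompletionIntegers K)
  obtain ⟨hρ0, hρ1⟩ := spectralValuation_uniformizer_pos_lt_one hw hϖ
  have hsum : ∑ j ∈ Finset.range n, Affine.Point.map ((((absoluteGaloisGroup.toAlgEquiv (v.adicCompletion K)) F : (AlgebraicClosure (v.adicCompletion K)) ≃ₐ[(v.adicCompletion K)] (AlgebraicClosure (v.adicCompletion K))) : (AlgebraicClosure (v.adicCompletion K)) →ₐ[(v.adicCompletion K)] (AlgebraicClosure (v.adicCompletion K))) ^ j) m₁ = 0 := by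
    rw [← hg₁Fn, cocycle_apply_pow hg₁ F n]
    exact Finset.sum_congr rfl fun j _ ↦ map_gal_pow F j m₁
  obtain ⟨Q, hQK, hQR, hQF⟩ := exists_map_sub_eq_of_sum_eq_zero
    (X := (W.localMinimalIntegralModel v).map (algebraMap (v.adicCompletionIntegers K) (v.adicCompletion K))) (Kn := Kn)
    (F := (((absoluteGaloisGroup.toAlgEquiv (v.adicCompletion K)) F : (AlgebraicClosure (v.adicCompletion K)) ≃ₐ[(v.adicCompletion K)] (AlgebraicClosure (v.adicCompletion K))) : (AlgebraicClosure (v.adicCompletion K)) →ₐ[(v.adicCompletion K)] (AlgebraicClosure (v.adicCompletion K)))) (n := n) hFw hFK hFn (π := (ϖ : (v.adicCompletion K))) rfl hρ0 hρ1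
    (fun x hx ↦ spectralValuation_le_uniformizer_of_mem_adjoin hw h𝔐 hm0 hmw hζpow hϖ x.2 hx)
    (fun a ha htr ↦ by
      obtain ⟨t', ht'mem, ht'1, ht'⟩ := exists_frob_sub_sub_lt_one hw hφq hn hζ ha (by
        rwa [Finset.sum_congr rfl fun j _ ↦ show ((((absoluteGaloisGroup.toAlgEquiv (v.adicCompletion K)) F : (AlgebraicClosure (v.adicCompletion K)) ≃ₐ[(v.adicCompletion K)] (AlgebraicClosure (v.adicCompletion K))) : (AlgebraicClosure (v.adicCompletion K)) →ₐ[(v.adicCompletion K)] (AlgebraicClosure (v.adicCompletion K))) ^ j) (a : (AlgebraicClosure (v.adicCompletion K))) =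
          (absoluteGaloisGroup.toAlgEquiv (v.adicCompletion K)) (F ^ j) a by rw [coe_gal_pow]; rfl] at htr)
      exact ⟨⟨t', ht'mem⟩, ht'1, ht'⟩)
    (fun z hz ↦ by
      obtain ⟨P, hPK, hPz, hPfix⟩ := exists_mem_kernel_zCoord_eq (w := w)
        ((W.localMinimalIntegralModel v).map (algebraMap (v.adicCompletionIntegers K) (v.adicCompletion K))) hz
      refine ⟨P, hPK, ?_, hPz⟩
      -- coordinates of `P` lie in `K_n`, by descent
      rcases hP : P with _ | ⟨x, y, h⟩
      · exact ⟨0, by rw [map_zero]; rfl⟩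
      · have hdesc : ∀ u : (AlgebraicClosure (v.adicCompletion K)), (u = x ∨ u = y) → u ∈ Kn := by
          intro u hu
          refine mem_adjoin_of_forall_smul_eq fun σ hσ ↦ ?_
          have hσz : (absoluteGaloisGroup.toAlgEquiv (v.adicCompletion K)) σ (z : (AlgebraicClosure (v.adicCompletion K))) = z :=
            algHom_apply_eq_self_of_mem_adjoin hm0 hζpow (((absoluteGaloisGroup.toAlgEquiv (v.adicCompletion K)) σ : (AlgebraicClosure (v.adicCompletion K)) ≃ₐ[(v.adicCompletion K)] (AlgebraicClosure (v.adicCompletion K))) : (AlgebraicClosure (v.adicCompletion K)) →ₐ[(v.adicCompletion K)] (AlgebraicClosure (v.adicCompletion K))) hσ z.2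
          have hσP := hPfix ((absoluteGaloisGroup.toAlgEquiv (v.adicCompletion K)) σ) (hσw σ) hσz
          rw [hP, Affine.Point.map_some] at hσP
          simp only [Affine.Point.some.injEq] at hσP
          rcases hu with rfl | rfl
          · exact hσP.1
          · exact hσP.2
        exact mem_range_map_val h (hdesc x (Or.inl rfl)) (hdesc y (Or.inr rfl)))
    (fun x hx ↦ exists_limit_of_mem_adjoin hw hm0 hζpow hρ1 x hx)
    hm₁K hm₁R hsum
  -- Step 4: `g₂ = g₁ - ∂Q` vanishes on `I` and at `F`, hence everywhere
  set g₂ : absoluteGaloisGroup (v.adicCompletion K) → ((((W.localMinimalIntegralModel v).map (algebraMap (v.adicCompletionIntegers K) (v.adicCompletion K))).baseChange (AlgebraicClosure (v.adicCompletion K)))).toAffine.Point := fun σ ↦ g₁ σ - (WeierstrassCurve.Affine.Point.map (W' := (W.localMinimalIntegralModel v).map (algebraMap (v.adicCompletionIntegers K) (v.adicCompletion K))) ((absoluteGaloisGroup.toAlgEquiv (v.adicCompletion K) (σ) : AlgebraicClosure (v.adicCompletion K) ≃ₐ[v.adicCompletion K] AlgebraicClosure (v.adicCompletion K)) : AlgebraicClosure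 (v.adicCompletion K) →ₐ[v.adicCompletion K] AlgebraicClosure (v.adicCompletion K)) Q - Q) with hg₂def
  have hg₂ : ∀ σ τ, g₂ (σ * τ) = g₂ σ + WeierstrassCurve.Affine.Point.map (W' := (W.localMinimalIntegralModel v).map (algebraMap (v.adicCompletionIntegers K) (v.adicCompletion K))) ((absoluteGaloisGroup.toAlgEquiv (v.adicCompletion K) (σ) : AlgebraicClosure (v.adicCompletion K) ≃ₐ[v.adicCompletion K] AlgebraicClosure (v.adicCompletion K)) : AlgebraicClosure (v.adicCompletion K) →ₐ[v.adicCompletion K] AlgebraicClosure (v.adicCompletion K)) (g₂ τ) := cocycle_sub_coboundary hg₁ Q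
  have hg₂F : g₂ F = 0 := by
    simp only [hg₂def]
    rw [sub_eq_zero]
    exact hQF.symm
  have hg₂I : ∀ τ ∈ 𝔐.inertia (absoluteGaloisGroup (v.adicCompletion K)), g₂ τ = 0 := by
    intro τ hτ
    have hτζ : τ • ζ = ζ := smul_eq_self_of_mem_inertia_of_pow_eq_one hw h𝔐 hτ hm0 hmw hζpow
    have hτQ : WeierstrassCurve.Affine.Point.map (W' := (W.localMinimalIntegralModel v).map (algebraMap (v.adicCompletionIntegers K) (v.adicCompletion K))) ((absoluteGaloisGroup.toAlgEquiv (v.adicCompletion K) (τ) : AlgebraicClosure (v.adicCompletion K) ≃ₐ[v.adicCompletion K] AlgebraicClosure (v.adicCompletion K)) : AlgebraicClosure (v.adicCompletion K) →ₐ[v.adicCompletion K] AlgebraicClosure (v.adicCompletion K)) Q = Q := map_eq_self_of_mem_range _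
      (fun x hx ↦ algHom_apply_eq_self_of_mem_adjoin hm0 hζpow _ hτζ hx) hQR
    simp only [hg₂def, hg₁I τ hτ, hτQ, sub_self]
  have hg₂open : IsOpen {σ | g₂ σ = 0} := isOpen_setOf_sub_coboundary_eq_zero hg₁ hg₁open Q
  obtain ⟨U, hU⟩ := exists_subgroup_coe_eq_setOf hg₂
  have hUtop : U = ⊤ := by
    refine eq_top_of_isOpen_of_frobenius_mem_of_inertia_le v h𝔐 hF (by rw [hU]; exact hg₂open) ?_ ?_
    · change F ∈ (U : Set (absoluteGaloisGroup (v.adicCompletion K))); rw [hU]; exact hg₂F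
    · intro τ hτ; change τ ∈ (U : Set (absoluteGaloisGroup (v.adicCompletion K))); rw [hU]; exact hg₂I τ hτ
  have hg₂zero : ∀ σ, g₂ σ = 0 := fun σ ↦ by
    have : σ ∈ (U : Set (absoluteGaloisGroup (v.adicCompletion K))) := by rw [hUtop]; trivial
    rwa [hU] at this
  refine ⟨b + Q, fun σ ↦ ?_⟩
  have := hg₂zero σ
  simp only [hg₂def, hg₁def, sub_eq_zero] at this
  rw [map_add]
  -- `g σ - (σb - b) = σQ - Q`
  have e : g σ = (WeierstrassCurve.Affine.Point.map (W' := (W.localMinimalIntegralModel v).map (algebraMap (v.adicCompletionIntegers K) (v.adicCompletion K))) ((absoluteGaloisGroup.toAlgEquiv (v.adicCompletion K) (σ) : AlgebraicClosure (v.adicCompletion K) ≃ₐ[v.adicCompletion K] AlgebraicClosure (v.adicCompletion K)) : AlgebraicClosure (v.adicCompletion K) →ₐ[v.adicCompletion K] AlgebraicClosure (v.adicCompletion K)) b - b) + (WeierstrassCurve.Affine.Point.map (W' := (W.localMinimalIntegralModel v).map (algebraMap (v.adicCompletionIntegers K) (v.adicCompletion K))) ((absoluteGaloisGroup.toAlgEquiv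 (v.adicCompletion K) (σ) : AlgebraicClosure (v.adicCompletion K) ≃ₐ[v.adicCompletion K] AlgebraicClosure (v.adicCompletion K)) : AlgebraicClosure (v.adicCompletion K) →ₐ[v.adicCompletion K] AlgebraicClosure (v.adicCompletion K)) Q - Q) := by rw [← this]; abel
  rw [e]; abel

end Main

end WeierstrassCurve

/-! ## Milne, ADT I.3.8, and the finiteness of the support (Clark–Sharif 2010, §1.1) -/

namespace Literature.NumberTheory.EllipticCurves

open Literature.NumberTheory.GaloisRepresentations IsDedekindDomain.HeightOneSpectrum WeierstrassCurve

/-- **Discharge of `Milne2006_unramifiedClass_eq_zero`** (Milne, *Arithmetic Duality Theorems*,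
Prop. I.3.8, good-reduction case; Tate 1962): a continuous crossed homomorphism
`f : Γ_{K_v} → E(K̄_v)` vanishing on the inertia group `I_𝔐` has trivial class. Proof: transport
`E(K̄_v) = localPoints W K_v` to the points of the good model `V = M ⊗ K̄_v`,
`M = W.localMinimalIntegralModel v`, equivariantly (`congrEquiv_smul`,
`VariableChange.pointEquivBaseChange_map_algEquiv`, `congrEquiv_baseChange_map`, as in
`SelmerFiniteProofs`), apply `WeierstrassCurve.exists_eq_map_sub_of_cocycle` (the zero set of `f`
is open as `f` is continuous into a discrete module), and conclude by
`oneCocycleClass_eq_zero_iff`. [cite: MilneADT2006, Ch. I Prop. 3.8] -/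
theorem Milne2006_unramifiedClass_eq_zero_holds : Milne2006_unramifiedClass_eq_zero.{u} := by
  intro K _ _ W _ v hv 𝔐 h𝔐 f hfI
  obtain ⟨w, hw⟩ := v.exists_spectralValuation
  obtain ⟨C, hC⟩ := W.exists_variableChange_eq_localMinimalIntegralModel v
  haveI := WeierstrassCurve.isIntegral_spectralValuation_baseChange hw (W.localMinimalIntegralModel v)
  have hC' := congrArg (fun X : WeierstrassCurve (v.adicCompletion K) ↦
    X.baseChange (AlgebraicClosure (v.adicCompletion K))) hC
  -- the equivariant transport `E(K̄_v) ≃ V(K̄_v)`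
  let Φ : localPoints W (v.adicCompletion K) ≃+
      (((W.localMinimalIntegralModel v).map (algebraMap (v.adicCompletionIntegers K)
        (v.adicCompletion K))).baseChange (AlgebraicClosure (v.adicCompletion K))).toAffine.Point :=
    ((WeierstrassCurve.Affine.Point.congrEquiv (WeierstrassCurve.baseChange_baseChange_adicCompletion W v).symm).trans
      (WeierstrassCurve.VariableChange.pointEquivBaseChange (W.baseChange (v.adicCompletion K)) C
        (AlgebraicClosure (v.adicCompletion K)))).trans
      (WeierstrassCurve.Affine.Point.congrEquiv hC')
  have hΦ : ∀ (σ : absoluteGaloisGroup (v.adicCompletion K)) (Q : localPoints W (v.adicCompletion K)),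
      Φ (σ • Q) = WeierstrassCurve.Affine.Point.map ((absoluteGaloisGroup.toAlgEquiv (v.adicCompletion K) σ :
          AlgebraicClosure (v.adicCompletion K) ≃ₐ[v.adicCompletion K] AlgebraicClosure (v.adicCompletion K)) :
          AlgebraicClosure (v.adicCompletion K) →ₐ[v.adicCompletion K] AlgebraicClosure (v.adicCompletion K))
        (Φ Q) := by
    intro σ Q
    change WeierstrassCurve.Affine.Point.congrEquiv hC' (WeierstrassCurve.VariableChange.pointEquivBaseChange (W.baseChange (v.adicCompletion K)) C
        (AlgebraicClosure (v.adicCompletion K))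
        (WeierstrassCurve.Affine.Point.congrEquiv (WeierstrassCurve.baseChange_baseChange_adicCompletion W v).symm (σ • Q))) =
      WeierstrassCurve.Affine.Point.map _ (WeierstrassCurve.Affine.Point.congrEquiv hC'
        (WeierstrassCurve.VariableChange.pointEquivBaseChange (W.baseChange (v.adicCompletion K)) C
          (AlgebraicClosure (v.adicCompletion K))
          (WeierstrassCurve.Affine.Point.congrEquiv (WeierstrassCurve.baseChange_baseChange_adicCompletion W v).symm Q)))
    rw [WeierstrassCurve.congrEquiv_smul, WeierstrassCurve.VariableChange.pointEquivBaseChange_map_algEquiv]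
    exact WeierstrassCurve.Affine.Point.congrEquiv_baseChange_map hC _ _
  -- the transported crossed homomorphism
  set g : absoluteGaloisGroup (v.adicCompletion K) → _ := fun σ ↦ Φ (f.1 σ) with hgdef
  have hg : ∀ σ τ, g (σ * τ) = g σ + WeierstrassCurve.Affine.Point.map ((absoluteGaloisGroup.toAlgEquiv (v.adicCompletion K) σ :
      AlgebraicClosure (v.adicCompletion K) ≃ₐ[v.adicCompletion K] AlgebraicClosure (v.adicCompletion K)) :
      AlgebraicClosure (v.adicCompletion K) →ₐ[v.adicCompletion K] AlgebraicClosure (v.adicCompletion K)) (g τ) := by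
    intro σ τ
    simp only [hgdef]
    rw [f.2 σ τ, map_add, discreteTopRep_ρ_apply, hΦ]
  have hopen : IsOpen {σ | g σ = 0} := by
    have e : {σ | g σ = 0} = f.1 ⁻¹' {0} := by
      ext σ
      simp only [hgdef, Set.mem_setOf_eq, Set.mem_preimage, Set.mem_singleton_iff]
      exact Φ.map_eq_zero_iff
    rw [e]
    exact (isOpen_discrete _).preimage f.1.continuous
  have hI : ∀ τ ∈ 𝔐.inertia (absoluteGaloisGroup (v.adicCompletion K)), g τ = 0 := fun τ hτ ↦ by
    simp only [hgdef, hfI τ hτ, map_zero]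
  obtain ⟨P, hP⟩ := WeierstrassCurve.exists_eq_map_sub_of_cocycle W hw hv h𝔐 g hg hopen hI
  rw [oneCocycleClass_eq_zero_iff]
  refine ⟨Φ.symm P, fun σ ↦ Φ.injective ?_⟩
  rw [discreteTopRep_ρ_apply, map_sub, hΦ, AddEquiv.apply_symm_apply]
  exact hP σ

/-- **Discharge of `finite_support`** (Clark–Sharif 2010, §1.1: a class `η ∈ H¹(K, E)` is
locally trivial at all but finitely many places): `finite_support_of_unramifiedClass_eq_zero`
(`PeriodIndexSupport`: outside the bad places and the places ramified in a trivialising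
extension, `η` restricts to an unramified class at a good place) fed with
`Milne2006_unramifiedClass_eq_zero_holds`. [cite: ClarkSharif2010, §1.1] -/
theorem finite_support_holds : finite_support.{u} :=
  finite_support_of_unramifiedClass_eq_zero Milne2006_unramifiedClass_eq_zero_holds

end Literature.NumberTheory.EllipticCurves
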